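import Mathlib
import HarnessLib
import Literature.MathematicalPhysics.QuantumLattice.GrassmannSourceGrading
import Summits.HubbardSuperconductivity.HubbardSuperconductivity.Theorems.KLProgrammeKLRegimeTwoVolumeLipDoubledDoorData

/-!
# Route `KLProgramme` — crux K3 ENGINE (stmt-HubbardSuperconductivity-20437), stub (e) proof-input «(e)-D-ROWS», keying (A′), REKEY-D file DT0:
# THE SOURCE-TRUNCATED OBJECTS OF THE DOUBLED (plain-track) TWO-VOLUME LIPSCHITZ TOWER AND THEIR UNGRADED DEEP SUPS
# (definitions; seat hubbard-kl-k3c4-p1 g28; design map HOME/hubbard-kl-k3c4-p1/REKEY-D.md §0/§2 «truncate to ≤ 2 source legs (srcTrunc 3 exact)»; `--supports` 23356)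

The doubled tower of `…TwoVolumeLipDoubledDefs` (D0) carries every number `s` of plain legs.  Its one-volume suppliers exist only for `s ≤ 2` (the sector tower's
profile for `s = 0`, token #24 `SourceProfilesAtLev` for `s = 1, 2`), and the VL read-out needs `s = 2` in degree `2` only.  Since the spectator covariance
`klLipCovD = C ⊕ 0` vanishes on the plain copy and the block substitutions `klLipTransferD = T ⊕ shift` send plain legs to plain legs, the part of source degree `< 3`
flows by itself (`Lit/GrassmannSourceGrading.srcTrunc_map_effAction_srcTrunc`: BGM 2006 §2.9, «`W_R` never feeds back»).  This file NAMES the truncated objects on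
which the doubled recursion (LIP + SRC + LINK + rows + budget + assembly) is run with ONE profile per degree — the sup-currency decision of REKEY-D-STATUS-g27 §D5:

* §1 one volume: **`klLipInputDT`** `:= srcTrunc 3 klLipInputD`, **`klLipBornDT`** `:= srcTrunc 3 klLipBornD` (source predicate = copy `1`), and the rate-`j_w` MEASURED size
  **`klLipInputMeasDT … d k j_w m`** (the sup over slots and pins of `Σ_{s<3}` of E1/k3c5-p3's graded weighted pinned sums `klSrcPinnedSumAt … (dk−1) j_w (dk) s m` — the
  doubled twin of E1's `klTowerMeasWtAt`);
* §2 two volumes: **`klLipInputDiffDT`**, **`klLipBornDiffDT`** (fine truncated object minus the doubled glue of the coarse one) and their UNGRADED deep sups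
  **`klLipInputDiffSupDT … m R`**, **`klLipBornDiffSupDT … m R`** (twins of `klLipInputDiffSup/klLipBornDiffSup` of `…TwoVolumeLipDiffDefs`);
* §3 rows: kernels (`kernel_klLipInputDT/BornDT`), the doubled glue commutes with the truncation (`klGlueD_srcTrunc`), the differences ARE the truncations of D0's
  differences (`klLipInputDiffDT_eq_srcTrunc`, `klLipBornDiffDT_eq_srcTrunc`), `fine = glue coarse + difference`, parity / constant parts, `le_ciSup` rows, nonnegativity,
  depth monotonicity, and the weighted pinned sum of `klLipInputDT` against E1's measured convention (`sum_wt_norm_kernel_klLipInputDT_eq`, `… ≤ ε·klLipInputMeasDT`).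

Definitions with bodies and bookkeeping rows only; nothing about the model is asserted; nothing asserts the (D) rows, (e), VL, K3 or superconductivity.
References: BGM 2006 §2.9 (4.3)–(4.8), §3 (3.2)–(3.8) [cite: BenfattoGiulianiMastropietro2006]; Salmhofer 1999 §4.3 (4.95).
-/

noncomputable section

namespace Summit.HubbardSuperconductivity.HubbardSuperconductivity.Theorems.TwoVolumeLip

set_option linter.dupNamespace false -- summit = problem name (single-conjunct summit), D-0017

open Finset Literature.MathematicalPhysics.QuantumLattice GrassmannAlgebra Literature.Probability.LatticeModels
open Literature.MathematicalPhysics.QuantumLattice.FermiRG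
open Summit.HubbardSuperconductivity.HubbardSuperconductivity.Theorems.KLRegimeSplit
open Summit.HubbardSuperconductivity.HubbardSuperconductivity.Theorems.KLProgrammeLegKernels
open Summit.HubbardSuperconductivity.HubbardSuperconductivity.Theorems.EngineV8
open Summit.HubbardSuperconductivity.HubbardSuperconductivity.Theorems.TwoVolumeSource
open Summit.HubbardSuperconductivity.HubbardSuperconductivity.Theorems.TwoVolumeDefect

/-! ## §1 One volume: the truncated doubled input / born increment and the measured size -/

section OneVolume

variable (V M : ℕ) [NeZero V]

/-- **`klLipInputDT V M β U μ K d k`** — the doubled analysed input of block `k` TRUNCATED to source degree `< 3` (at most two plain legs):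
`srcTrunc 3 (klLipInputD … d k)` for the source predicate «copy `1`». -/
def klLipInputDT (β U μ : ℝ) (K : TrigPolyC4v) (d k : ℕ) : GrassmannAlgebra ℂ (SrcLabel V M (d * k - 1)) :=
  srcTrunc ℂ (fun Y : SrcLabel V M (d * k - 1) => Y.2 = 1) 3 (klLipInputD V M β U μ K d k)

/-- **`klLipBornDT V M β U μ K d k`** — the doubled born increment of block `k` truncated to source degree `< 3`. -/
def klLipBornDT (β U μ : ℝ) (K : TrigPolyC4v) (d k : ℕ) : GrassmannAlgebra ℂ (SrcLabel V M (d * k)) :=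
  srcTrunc ℂ (fun Y : SrcLabel V M (d * k) => Y.2 = 1) 3 (klLipBornD V M β U μ K d k)

/-- **`klLipInputMeasDT V M β U μ K d k j_w m`** — the rate-`j_w` MEASURED size of the truncated doubled input of block `k` in degree `m`: the supremum over the slots `q`
and pins `w` of `Σ_{s<3} klSrcPinnedSumAt V M β U μ K (dk−1) j_w (dk) s m q w` (E1's `ε^{m−1}`/`klScaleWt`-convention; the doubled twin of `klTowerMeasWtAt … d k j_w m`). -/
def klLipInputMeasDT (β U μ : ℝ) (K : TrigPolyC4v) (d k jw m : ℕ) : ℝ :=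
  ⨆ qw : Fin m × SrcLabel V M (d * k - 1), ∑ s ∈ range 3, klSrcPinnedSumAt V M β U μ K (d * k - 1) jw (d * k) s m qw.1 qw.2

variable {V M}

/-- Unfolding `klLipInputDT`. -/
theorem klLipInputDT_def (β U μ : ℝ) (K : TrigPolyC4v) (d k : ℕ) :
    klLipInputDT V M β U μ K d k = srcTrunc ℂ (fun Y : SrcLabel V M (d * k - 1) => Y.2 = 1) 3 (klLipInputD V M β U μ K d k) := rfl

/-- Unfolding `klLipBornDT`. -/
theorem klLipBornDT_def (β U μ : ℝ) (K : TrigPolyC4v) (d k : ℕ) :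
    klLipBornDT V M β U μ K d k = srcTrunc ℂ (fun Y : SrcLabel V M (d * k) => Y.2 = 1) 3 (klLipBornD V M β U μ K d k) := rfl

/-- Unfolding `klLipInputMeasDT`. -/
theorem klLipInputMeasDT_def (β U μ : ℝ) (K : TrigPolyC4v) (d k jw m : ℕ) :
    klLipInputMeasDT V M β U μ K d k jw m =
      ⨆ qw : Fin m × SrcLabel V M (d * k - 1), ∑ s ∈ range 3, klSrcPinnedSumAt V M β U μ K (d * k - 1) jw (d * k) s m qw.1 qw.2 := rfl

/-- **Kernels of the truncated input**: `[srcCount X < 3] · ε^m · kernel (klSrcActionAt … (dk−1) (dk)) m X`. -/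
theorem kernel_klLipInputDT (β U μ : ℝ) (K : TrigPolyC4v) (d k m : ℕ) (X : Fin m → SrcLabel V M (d * k - 1)) :
    kernel ℂ (klLipInputDT V M β U μ K d k) m X =
      if srcCount (fun Y : SrcLabel V M (d * k - 1) => Y.2 = 1) X < 3 then
        (((imagTimeWeight β M : ℝ) : ℂ)) ^ m * kernel ℂ (klSrcActionAt V M β U μ K (d * k - 1) (d * k)) m X else 0 := by
  rw [klLipInputDT, kernel_srcTrunc, kernel_klLipInputD]

/-- Kernels of the truncated input below source degree `3` are those of `klLipInputD`. -/
theorem kernel_klLipInputDT_of_lt (β U μ : ℝ) (K : TrigPolyC4v) (d k m : ℕ) {X : Fin m → SrcLabel V M (d * k - 1)}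
    (hX : srcCount (fun Y : SrcLabel V M (d * k - 1) => Y.2 = 1) X < 3) :
    kernel ℂ (klLipInputDT V M β U μ K d k) m X = kernel ℂ (klLipInputD V M β U μ K d k) m X := by
  rw [klLipInputDT, kernel_srcTrunc_of_lt _ _ _ hX]

/-- Kernels of the truncated born increment: `[srcCount X < 3] · kernel klLipBornD`. -/
theorem kernel_klLipBornDT (β U μ : ℝ) (K : TrigPolyC4v) (d k m : ℕ) (X : Fin m → SrcLabel V M (d * k)) :
    kernel ℂ (klLipBornDT V M β U μ K d k) m X =
      if srcCount (fun Y : SrcLabel V M (d * k) => Y.2 = 1) X < 3 then kernel ℂ (klLipBornD V M β U μ K d k) m X else 0 := by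
  rw [klLipBornDT, kernel_srcTrunc]

/-- The truncated input is even when the input is. -/
theorem klLipInputDT_mem_evenOdd_zero {β U μ : ℝ} {K : TrigPolyC4v} {d k : ℕ} (h : klTowerInput V M β U μ K d k ∈ evenOdd ℂ 0) :
    klLipInputDT V M β U μ K d k ∈ evenOdd ℂ 0 :=
  srcTrunc_mem_evenPart ℂ _ 3 (map_mem_evenOdd_zero ℂ _ h)

/-- The truncated input has no constant part when the input has none. -/
theorem constPart_klLipInputDT {β U μ : ℝ} {K : TrigPolyC4v} {d k : ℕ} (h : constPart ℂ (klTowerInput V M β U μ K d k) = 0) :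
    constPart ℂ (klLipInputDT V M β U μ K d k) = 0 :=
  constPart_srcTrunc_eq_zero ℂ _ 3 (by rw [klLipInputD_def, constPart_map, h])

/-- **The `klScaleWt`-weighted pinned sum of the truncated input, read through `Prod.fst`, IS `ε × Σ_{s<3}` of E1/k3c5-p3's graded weighted pinned sums** (`m ≥ 1`). -/
theorem sum_wt_norm_kernel_klLipInputDT_eq {β : ℝ} (hβ : 0 ≤ β) (U μ : ℝ) (K : TrigPolyC4v) (d k jw : ℕ) {m : ℕ} (q : Fin m)
    (w : SrcLabel V M (d * k - 1)) :
    ∑ X ∈ univ.filter (fun X : Fin m → SrcLabel V M (d * k - 1) => X q = w),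
        ‖kernel ℂ (klLipInputDT V M β U μ K d k) m X‖ * klLabelWt (klScaleWt V M β jw) ((univ.image X).image Prod.fst) =
      imagTimeWeight β M * ∑ s ∈ range 3, klSrcPinnedSumAt V M β U μ K (d * k - 1) jw (d * k) s m q w := by
  classical
  obtain ⟨n, rfl⟩ : ∃ n, m = n + 1 := ⟨m - 1, by have := q.pos; omega⟩
  have hε : 0 ≤ imagTimeWeight β M := imagTimeWeight_nonneg hβ M
  -- split the left sum by the source count (values `< 3` only contribute)
  have hsplit : ∀ X : Fin (n + 1) → SrcLabel V M (d * k - 1),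
      ‖kernel ℂ (klLipInputDT V M β U μ K d k) (n + 1) X‖ * klLabelWt (klScaleWt V M β jw) ((univ.image X).image Prod.fst) =
        ∑ s ∈ range 3, if srcCount (fun Y : SrcLabel V M (d * k - 1) => Y.2 = 1) X = s then
          imagTimeWeight β M ^ (n + 1) * (klScaleWt V M β jw ((univ.image X).image (srcLegPos V M (2 * (2 * M)))) *
            ‖kernel ℂ (klSrcActionAt V M β U μ K (d * k - 1) (d * k)) (n + 1) X‖) else 0 := by
    intro X
    rw [kernel_klLipInputDT]
    have himg : ((univ.image X).image Prod.fst).image (latticeLegPos (2 * (2 * M))) = (univ.image X).image (srcLegPos V M (2 * (2 * M))) := by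
      rw [Finset.image_image]; rfl
    by_cases hX : srcCount (fun Y : SrcLabel V M (d * k - 1) => Y.2 = 1) X < 3
    · rw [if_pos hX, Finset.sum_ite_eq, if_pos (mem_range.2 hX), norm_mul, norm_pow, Complex.norm_real, Real.norm_of_nonneg hε,
        klLabelWt_apply, himg]
      ring
    · rw [if_neg hX, norm_zero, zero_mul, sum_eq_zero]
      intro s hs
      rw [if_neg]
      rintro rfl
      exact hX (mem_range.1 hs)
  rw [sum_congr rfl fun X _ => hsplit X, sum_comm, mul_sum]
  refine sum_congr rfl fun s _ => ?_
  rw [klSrcPinnedSumAt_def, Nat.add_sub_cancel, ← sum_filter, filter_filter, mul_sum, mul_sum]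
  refine sum_congr rfl fun X _ => ?_
  ring

/-- Every `Σ_{s<3}` of the graded weighted pinned sums is at most the measured size. -/
theorem sum_klSrcPinnedSumAt_le_klLipInputMeasDT (β U μ : ℝ) (K : TrigPolyC4v) (d k jw m : ℕ) (q : Fin m) (w : SrcLabel V M (d * k - 1)) :
    ∑ s ∈ range 3, klSrcPinnedSumAt V M β U μ K (d * k - 1) jw (d * k) s m q w ≤ klLipInputMeasDT V M β U μ K d k jw m :=
  le_ciSup (f := fun qw : Fin m × SrcLabel V M (d * k - 1) =>
    ∑ s ∈ range 3, klSrcPinnedSumAt V M β U μ K (d * k - 1) jw (d * k) s m qw.1 qw.2) (Set.finite_range _).bddAbove (q, w)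

/-- **The weighted pinned sums of the truncated input are at most `ε · klLipInputMeasDT`** (`0 ≤ β`). -/
theorem sum_wt_norm_kernel_klLipInputDT_le {β : ℝ} (hβ : 0 ≤ β) (U μ : ℝ) (K : TrigPolyC4v) (d k jw : ℕ) {m : ℕ} (q : Fin m)
    (w : SrcLabel V M (d * k - 1)) :
    ∑ X ∈ univ.filter (fun X : Fin m → SrcLabel V M (d * k - 1) => X q = w),
        ‖kernel ℂ (klLipInputDT V M β U μ K d k) m X‖ * klLabelWt (klScaleWt V M β jw) ((univ.image X).image Prod.fst) ≤
      imagTimeWeight β M * klLipInputMeasDT V M β U μ K d k jw m := by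
  rw [sum_wt_norm_kernel_klLipInputDT_eq hβ]
  exact mul_le_mul_of_nonneg_left (sum_klSrcPinnedSumAt_le_klLipInputMeasDT β U μ K d k jw m q w) (imagTimeWeight_nonneg hβ M)

/-- The measured size is nonnegative (`0 ≤ β`). -/
theorem klLipInputMeasDT_nonneg {β : ℝ} (hβ : 0 ≤ β) (U μ : ℝ) (K : TrigPolyC4v) (d k jw m : ℕ) : 0 ≤ klLipInputMeasDT V M β U μ K d k jw m := by
  rw [klLipInputMeasDT]
  rcases isEmpty_or_nonempty (Fin m × SrcLabel V M (d * k - 1)) with h | h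
  · rw [Real.iSup_of_isEmpty]
  · exact Real.iSup_nonneg fun _ => sum_nonneg fun s _ => klSrcPinnedSumAt_nonneg hβ U μ K _ _ _ s m _ _

end OneVolume

/-! ## §2 Two volumes: the truncated differences and their ungraded deep sups -/

section TwoVolumes

variable (L b M : ℕ) [NeZero L] [NeZero (b * L)]

/-- **`klLipInputDiffDT L b M β U μ K d k`** — the truncated doubled two-volume INPUT difference of block `k` at the common frame `K`. -/
def klLipInputDiffDT (β U μ : ℝ) (K : TrigPolyC4v) (d k : ℕ) : GrassmannAlgebra ℂ (SrcLabel (b * L) M (d * k - 1)) :=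
  klLipInputDT (b * L) M β U μ K d k - klGlueD L b M (d * k - 1) (klLipInputDT L M β U μ K d k)

/-- **`klLipBornDiffDT L b M β U μ K d k`** — the truncated doubled two-volume BORN difference of block `k` at the common frame `K`. -/
def klLipBornDiffDT (β U μ : ℝ) (K : TrigPolyC4v) (d k : ℕ) : GrassmannAlgebra ℂ (SrcLabel (b * L) M (d * k)) :=
  klLipBornDT (b * L) M β U μ K d k - klGlueD L b M (d * k) (klLipBornDT L M β U μ K d k)

/-- **`klLipInputDiffSupDT L b M β U μ K d k m R`** — the UNGRADED deep sup of the truncated input difference of block `k` in degree `m`: the supremum over slots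
`q < m` and `R`-deep fine pins `w` (either copy) of `Σ_{X : X q = w} ‖kernel (klLipInputDiffDT …) m X‖`. -/
def klLipInputDiffSupDT (β U μ : ℝ) (K : TrigPolyC4v) (d k m R : ℕ) : ℝ :=
  ⨆ qw : Fin m × {w : SrcLabel (b * L) M (d * k - 1) // w ∈ klDeepPinsD (V := b * L) (M := M) (n := d * k - 1) L R},
    ∑ X ∈ univ.filter (fun X : Fin m → SrcLabel (b * L) M (d * k - 1) => X qw.1 = qw.2.1), ‖kernel ℂ (klLipInputDiffDT L b M β U μ K d k) m X‖

/-- **`klLipBornDiffSupDT L b M β U μ K d k m R`** — the ungraded deep sup of the truncated BORN difference of block `k` in degree `m`. -/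
def klLipBornDiffSupDT (β U μ : ℝ) (K : TrigPolyC4v) (d k m R : ℕ) : ℝ :=
  ⨆ qw : Fin m × {w : SrcLabel (b * L) M (d * k) // w ∈ klDeepPinsD (V := b * L) (M := M) (n := d * k) L R},
    ∑ X ∈ univ.filter (fun X : Fin m → SrcLabel (b * L) M (d * k) => X qw.1 = qw.2.1), ‖kernel ℂ (klLipBornDiffDT L b M β U μ K d k) m X‖

variable {L b M}

/-- Unfolding `klLipInputDiffDT`. -/
theorem klLipInputDiffDT_def (β U μ : ℝ) (K : TrigPolyC4v) (d k : ℕ) :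
    klLipInputDiffDT L b M β U μ K d k = klLipInputDT (b * L) M β U μ K d k - klGlueD L b M (d * k - 1) (klLipInputDT L M β U μ K d k) := rfl

/-- Unfolding `klLipBornDiffDT`. -/
theorem klLipBornDiffDT_def (β U μ : ℝ) (K : TrigPolyC4v) (d k : ℕ) :
    klLipBornDiffDT L b M β U μ K d k = klLipBornDT (b * L) M β U μ K d k - klGlueD L b M (d * k) (klLipBornDT L M β U μ K d k) := rfl

/-- Unfolding `klLipInputDiffSupDT`. -/
theorem klLipInputDiffSupDT_def (β U μ : ℝ) (K : TrigPolyC4v) (d k m R : ℕ) :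
    klLipInputDiffSupDT L b M β U μ K d k m R =
      ⨆ qw : Fin m × {w : SrcLabel (b * L) M (d * k - 1) // w ∈ klDeepPinsD (V := b * L) (M := M) (n := d * k - 1) L R},
        ∑ X ∈ univ.filter (fun X : Fin m → SrcLabel (b * L) M (d * k - 1) => X qw.1 = qw.2.1),
          ‖kernel ℂ (klLipInputDiffDT L b M β U μ K d k) m X‖ := rfl

/-- Unfolding `klLipBornDiffSupDT`. -/
theorem klLipBornDiffSupDT_def (β U μ : ℝ) (K : TrigPolyC4v) (d k m R : ℕ) :
    klLipBornDiffSupDT L b M β U μ K d k m R =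
      ⨆ qw : Fin m × {w : SrcLabel (b * L) M (d * k) // w ∈ klDeepPinsD (V := b * L) (M := M) (n := d * k) L R},
        ∑ X ∈ univ.filter (fun X : Fin m → SrcLabel (b * L) M (d * k) => X qw.1 = qw.2.1),
          ‖kernel ℂ (klLipBornDiffDT L b M β U μ K d k) m X‖ := rfl

/-- `fine truncated input = doubled glue of the coarse one + truncated difference` (the `V + D` of the deep doors). -/
theorem klLipInputDT_fine_eq (β U μ : ℝ) (K : TrigPolyC4v) (d k : ℕ) :
    klLipInputDT (b * L) M β U μ K d k = klGlueD L b M (d * k - 1) (klLipInputDT L M β U μ K d k) + klLipInputDiffDT L b M β U μ K d k := by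
  rw [klLipInputDiffDT, add_sub_cancel]

end TwoVolumes

/-! ## §3 The doubled glue commutes with the truncation; the differences are truncations; sup rows -/

section GlueTrunc

variable {L b M : ℕ} [NeZero L] [NeZero (b * L)] {n : ℕ}

/-- An element of a finite Grassmann algebra is determined by its kernels (the kernel expansion `eq_sum_presented_kernel`). -/
private theorem eq_of_kernel_eq {Γ : Type*} [Fintype Γ] [DecidableEq Γ] {F G : GrassmannAlgebra ℂ Γ}
    (h : ∀ (m : ℕ) (X : Fin m → Γ), kernel ℂ F m X = kernel ℂ G m X) : F = G := by
  rw [eq_sum_presented_kernel ℂ F, eq_sum_presented_kernel ℂ G]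
  exact sum_congr rfl fun m _ => by rw [show kernel ℂ F m = kernel ℂ G m from funext (h m)]

/-- The residue map of the doubled block structure preserves the copy. -/
theorem klBlockEquivD_snd_snd [NeZero M] (Y : SrcLabel (b * L) M n) : ((klBlockEquivD L b M n Y).2).2 = Y.2 := by
  obtain ⟨x, s⟩ := Y
  rw [klBlockEquivD_apply]

/-- The residue map of the doubled block structure preserves the source count. -/
theorem srcCount_blockRes_eq [NeZero M] {m : ℕ} (X' : Fin m → SrcLabel (b * L) M n) :
    srcCount (fun Y : SrcLabel L M n => Y.2 = 1) (fun i => (klBlockEquivD L b M n (X' i)).2) =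
      srcCount (fun Y' : SrcLabel (b * L) M n => Y'.2 = 1) X' := by
  unfold srcCount
  congr 1
  refine filter_congr fun i _ => ?_
  show ((klBlockEquivD L b M n (X' i)).2).2 = 1 ↔ (X' i).2 = 1
  rw [klBlockEquivD_snd_snd]

/-- **The doubled glue commutes with the source truncation**: `klGlueD (srcTrunc 3 W) = srcTrunc 3 (klGlueD W)`. -/
theorem klGlueD_srcTrunc [NeZero M] (W : GrassmannAlgebra ℂ (SrcLabel L M n)) :
    klGlueD L b M n (srcTrunc ℂ (fun Y : SrcLabel L M n => Y.2 = 1) 3 W) =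
      srcTrunc ℂ (fun Y' : SrcLabel (b * L) M n => Y'.2 = 1) 3 (klGlueD L b M n W) := by
  classical
  refine eq_of_kernel_eq fun m X' => ?_
  rw [kernel_srcTrunc, klGlueD_def, klGlueD_def, kernel_sum, kernel_sum,
    sum_congr rfl fun B _ => kernel_map_blockEmb (klBlockEquivD L b M n) (klBlockEmbD_apply B) _ m X',
    sum_congr rfl fun B _ => kernel_map_blockEmb (klBlockEquivD L b M n) (klBlockEmbD_apply B) W m X']
  simp only [kernel_srcTrunc, srcCount_blockRes_eq]
  split_ifs with h <;> simp

/-- **The truncated input difference IS the truncation of D0's input difference.** -/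
theorem klLipInputDiffDT_eq_srcTrunc [NeZero M] (β U μ : ℝ) (K : TrigPolyC4v) (d k : ℕ) :
    klLipInputDiffDT L b M β U μ K d k = srcTrunc ℂ (fun Y' : SrcLabel (b * L) M (d * k - 1) => Y'.2 = 1) 3 (klLipInputDiffD L b M β U μ K d k) := by
  rw [klLipInputDiffDT, klLipInputDT, klLipInputDT, klGlueD_srcTrunc, klLipInputDiffD_def, srcTrunc_sub]

/-- **The truncated born difference IS the truncation of D0's born difference.** -/
theorem klLipBornDiffDT_eq_srcTrunc [NeZero M] (β U μ : ℝ) (K : TrigPolyC4v) (d k : ℕ) :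
    klLipBornDiffDT L b M β U μ K d k = srcTrunc ℂ (fun Y' : SrcLabel (b * L) M (d * k) => Y'.2 = 1) 3 (klLipBornDiffD L b M β U μ K d k) := by
  rw [klLipBornDiffDT, klLipBornDT, klLipBornDT, klGlueD_srcTrunc, klLipBornDiffD_def, srcTrunc_sub]

/-- Kernels of the truncated input difference: `[srcCount X < 3] · kernel klLipInputDiffD`. -/
theorem kernel_klLipInputDiffDT [NeZero M] (β U μ : ℝ) (K : TrigPolyC4v) (d k m : ℕ) (X : Fin m → SrcLabel (b * L) M (d * k - 1)) :
    kernel ℂ (klLipInputDiffDT L b M β U μ K d k) m X =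
      if srcCount (fun Y' : SrcLabel (b * L) M (d * k - 1) => Y'.2 = 1) X < 3 then kernel ℂ (klLipInputDiffD L b M β U μ K d k) m X else 0 := by
  rw [klLipInputDiffDT_eq_srcTrunc, kernel_srcTrunc]

/-- Kernels of the truncated born difference: `[srcCount X < 3] · kernel klLipBornDiffD`. -/
theorem kernel_klLipBornDiffDT [NeZero M] (β U μ : ℝ) (K : TrigPolyC4v) (d k m : ℕ) (X : Fin m → SrcLabel (b * L) M (d * k)) :
    kernel ℂ (klLipBornDiffDT L b M β U μ K d k) m X =
      if srcCount (fun Y' : SrcLabel (b * L) M (d * k) => Y'.2 = 1) X < 3 then kernel ℂ (klLipBornDiffD L b M β U μ K d k) m X else 0 := by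
  rw [klLipBornDiffDT_eq_srcTrunc, kernel_srcTrunc]

/-- The truncated input difference is even when both inputs are. -/
theorem klLipInputDiffDT_mem_evenOdd_zero [NeZero M] {β U μ : ℝ} {K : TrigPolyC4v} {d k : ℕ}
    (hf : klTowerInput (b * L) M β U μ K d k ∈ evenOdd ℂ 0) (hc : klTowerInput L M β U μ K d k ∈ evenOdd ℂ 0) :
    klLipInputDiffDT L b M β U μ K d k ∈ evenOdd ℂ 0 := by
  rw [klLipInputDiffDT_eq_srcTrunc]
  exact srcTrunc_mem_evenPart ℂ _ 3 (klLipInputDiffD_mem_evenOdd_zero hf hc)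

/-- The truncated input difference has no constant part when the inputs have none. -/
theorem constPart_klLipInputDiffDT [NeZero M] {β U μ : ℝ} {K : TrigPolyC4v} {d k : ℕ}
    (hf : constPart ℂ (klTowerInput (b * L) M β U μ K d k) = 0) (hc : constPart ℂ (klTowerInput L M β U μ K d k) = 0) :
    constPart ℂ (klLipInputDiffDT L b M β U μ K d k) = 0 := by
  rw [klLipInputDiffDT_eq_srcTrunc]
  exact constPart_srcTrunc_eq_zero ℂ _ 3 (constPart_klLipInputDiffD hf hc)

/-- Every pinned profile of the truncated input difference at a deep pin is below the sup. -/
theorem sum_le_klLipInputDiffSupDT [NeZero M] (β U μ : ℝ) (K : TrigPolyC4v) (d k m R : ℕ) (q : Fin m)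
    {w : SrcLabel (b * L) M (d * k - 1)} (hw : w ∈ klDeepPinsD (V := b * L) (M := M) (n := d * k - 1) L R) :
    ∑ X ∈ univ.filter (fun X : Fin m → SrcLabel (b * L) M (d * k - 1) => X q = w), ‖kernel ℂ (klLipInputDiffDT L b M β U μ K d k) m X‖ ≤
      klLipInputDiffSupDT L b M β U μ K d k m R :=
  le_ciSup (f := fun qw : Fin m × {w : SrcLabel (b * L) M (d * k - 1) // w ∈ klDeepPinsD (V := b * L) (M := M) (n := d * k - 1) L R} =>
    ∑ X ∈ univ.filter (fun X : Fin m → SrcLabel (b * L) M (d * k - 1) => X qw.1 = qw.2.1), ‖kernel ℂ (klLipInputDiffDT L b M β U μ K d k) m X‖)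
    (Finite.bddAbove_range _) (q, ⟨w, hw⟩)

/-- Every pinned profile of the truncated born difference at a deep pin is below the sup. -/
theorem sum_le_klLipBornDiffSupDT [NeZero M] (β U μ : ℝ) (K : TrigPolyC4v) (d k m R : ℕ) (q : Fin m)
    {w : SrcLabel (b * L) M (d * k)} (hw : w ∈ klDeepPinsD (V := b * L) (M := M) (n := d * k) L R) :
    ∑ X ∈ univ.filter (fun X : Fin m → SrcLabel (b * L) M (d * k) => X q = w), ‖kernel ℂ (klLipBornDiffDT L b M β U μ K d k) m X‖ ≤
      klLipBornDiffSupDT L b M β U μ K d k m R :=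
  le_ciSup (f := fun qw : Fin m × {w : SrcLabel (b * L) M (d * k) // w ∈ klDeepPinsD (V := b * L) (M := M) (n := d * k) L R} =>
    ∑ X ∈ univ.filter (fun X : Fin m → SrcLabel (b * L) M (d * k) => X qw.1 = qw.2.1), ‖kernel ℂ (klLipBornDiffDT L b M β U μ K d k) m X‖)
    (Finite.bddAbove_range _) (q, ⟨w, hw⟩)

/-- The ungraded deep sups are nonnegative (input). -/
theorem klLipInputDiffSupDT_nonneg (β U μ : ℝ) (K : TrigPolyC4v) (d k m R : ℕ) : 0 ≤ klLipInputDiffSupDT L b M β U μ K d k m R := by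
  rw [klLipInputDiffSupDT]
  rcases isEmpty_or_nonempty (Fin m × {w : SrcLabel (b * L) M (d * k - 1) // w ∈ klDeepPinsD (V := b * L) (M := M) (n := d * k - 1) L R}) with h | h
  · rw [Real.iSup_of_isEmpty]
  · exact Real.iSup_nonneg fun _ => sum_nonneg fun _ _ => norm_nonneg _

/-- The ungraded deep sups are nonnegative (born). -/
theorem klLipBornDiffSupDT_nonneg (β U μ : ℝ) (K : TrigPolyC4v) (d k m R : ℕ) : 0 ≤ klLipBornDiffSupDT L b M β U μ K d k m R := by
  rw [klLipBornDiffSupDT]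
  rcases isEmpty_or_nonempty (Fin m × {w : SrcLabel (b * L) M (d * k) // w ∈ klDeepPinsD (V := b * L) (M := M) (n := d * k) L R}) with h | h
  · rw [Real.iSup_of_isEmpty]
  · exact Real.iSup_nonneg fun _ => sum_nonneg fun _ _ => norm_nonneg _

/-- Monotonicity in the depth (input): a larger `R` restricts the pins. -/
theorem klLipInputDiffSupDT_anti [NeZero M] (β U μ : ℝ) (K : TrigPolyC4v) (d k m : ℕ) {R R' : ℕ} (h : R ≤ R') :
    klLipInputDiffSupDT L b M β U μ K d k m R' ≤ klLipInputDiffSupDT L b M β U μ K d k m R := by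
  rcases isEmpty_or_nonempty (Fin m × {w : SrcLabel (b * L) M (d * k - 1) // w ∈ klDeepPinsD (V := b * L) (M := M) (n := d * k - 1) L R'}) with h' | h'
  · rw [klLipInputDiffSupDT_def β U μ K d k m R', Real.iSup_of_isEmpty]
    exact klLipInputDiffSupDT_nonneg β U μ K d k m R
  · rw [klLipInputDiffSupDT_def β U μ K d k m R']
    refine ciSup_le fun qw => sum_le_klLipInputDiffSupDT β U μ K d k m R qw.1 ?_
    exact mem_klDeepPinsD.2 (klDeepPins_mono h (mem_klDeepPinsD.1 qw.2.2))

/-- Monotonicity in the depth (born). -/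
theorem klLipBornDiffSupDT_anti [NeZero M] (β U μ : ℝ) (K : TrigPolyC4v) (d k m : ℕ) {R R' : ℕ} (h : R ≤ R') :
    klLipBornDiffSupDT L b M β U μ K d k m R' ≤ klLipBornDiffSupDT L b M β U μ K d k m R := by
  rcases isEmpty_or_nonempty (Fin m × {w : SrcLabel (b * L) M (d * k) // w ∈ klDeepPinsD (V := b * L) (M := M) (n := d * k) L R'}) with h' | h'
  · rw [klLipBornDiffSupDT_def β U μ K d k m R', Real.iSup_of_isEmpty]
    exact klLipBornDiffSupDT_nonneg β U μ K d k m R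
  · rw [klLipBornDiffSupDT_def β U μ K d k m R']
    refine ciSup_le fun qw => sum_le_klLipBornDiffSupDT β U μ K d k m R qw.1 ?_
    exact mem_klDeepPinsD.2 (klDeepPins_mono h (mem_klDeepPinsD.1 qw.2.2))

/-- The ungraded deep sup of the born difference is attained-bounded: if every deep pinned profile is `≤ B` (`0 ≤ B`), so is the sup. -/
theorem klLipBornDiffSupDT_le_of_forall [NeZero M] (β U μ : ℝ) (K : TrigPolyC4v) (d k m R : ℕ) {B : ℝ} (hB : 0 ≤ B)
    (h : ∀ (q : Fin m) (w : SrcLabel (b * L) M (d * k)), w ∈ klDeepPinsD (V := b * L) (M := M) (n := d * k) L R →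
      ∑ X ∈ univ.filter (fun X : Fin m → SrcLabel (b * L) M (d * k) => X q = w), ‖kernel ℂ (klLipBornDiffDT L b M β U μ K d k) m X‖ ≤ B) :
    klLipBornDiffSupDT L b M β U μ K d k m R ≤ B := by
  rw [klLipBornDiffSupDT]
  rcases isEmpty_or_nonempty (Fin m × {w : SrcLabel (b * L) M (d * k) // w ∈ klDeepPinsD (V := b * L) (M := M) (n := d * k) L R}) with h' | h'
  · rw [Real.iSup_of_isEmpty]; exact hB
  · exact ciSup_le fun qw => h qw.1 qw.2.1 qw.2.2

/-- The same for the input difference. -/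
theorem klLipInputDiffSupDT_le_of_forall [NeZero M] (β U μ : ℝ) (K : TrigPolyC4v) (d k m R : ℕ) {B : ℝ} (hB : 0 ≤ B)
    (h : ∀ (q : Fin m) (w : SrcLabel (b * L) M (d * k - 1)), w ∈ klDeepPinsD (V := b * L) (M := M) (n := d * k - 1) L R →
      ∑ X ∈ univ.filter (fun X : Fin m → SrcLabel (b * L) M (d * k - 1) => X q = w), ‖kernel ℂ (klLipInputDiffDT L b M β U μ K d k) m X‖ ≤ B) :
    klLipInputDiffSupDT L b M β U μ K d k m R ≤ B := by
  rw [klLipInputDiffSupDT]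
  rcases isEmpty_or_nonempty (Fin m × {w : SrcLabel (b * L) M (d * k - 1) // w ∈ klDeepPinsD (V := b * L) (M := M) (n := d * k - 1) L R}) with h' | h'
  · rw [Real.iSup_of_isEmpty]; exact hB
  · exact ciSup_le fun qw => h qw.1 qw.2.1 qw.2.2

end GlueTrunc

end Summit.HubbardSuperconductivity.HubbardSuperconductivity.Theorems.TwoVolumeLip

end
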